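import Literature.NumberTheory.Transcendental.GaGmIsogeny
import Mathlib.Analysis.Fourier.FiniteAbelian.Orthogonality
import Mathlib.RingTheory.RootsOfUnity.Complex
import Mathlib.GroupTheory.Index
import HarnessLib

/-!
# The power isogenies of `G = 𝔾ₐ × 𝔾ₘⁿ`: the index bookkeeping (coset counts versus lattice index)

Topic `Literature/NumberTheory/Transcendental`. Second part of the isogeny toolkit
(`GaGmIsogeny.lean`) for the reduction of Philippon's zero estimate with unequal torus degrees
(Nesterenko 2003, Prop. 5.1) to equal degrees along `φ_k(x, y) = (x, y_j^{k_j})`. When the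
equal-degree theorem is applied to `φ_k^* Q` at the points of `φ_k⁻¹(Σ)`, its coset count
`card((φ_k⁻¹Σ · H')/H')` exceeds the downstairs count `card((Σ · H)/H)` (`φ_k(H') ≤ H`) by the
factor `ι = [ker φ_k : ker φ_k ∩ H']`; on the other side the minors of the pulled-back character
lattice `kΦ ⊆ Φ' = X(H')⊥` are those of `Φ'` times the lattice index `ι' = [Φ' : Φ' ∩ kℤⁿ]`. The
two indices compensate because `ι' ≤ ι` — the characters `ζ ↦ ζ^ψ` (`ψ ∈ Φ'`) of the finite
abelian group `ker φ_k / (ker φ_k ∩ H')` separate `Φ'/(Φ' ∩ kℤⁿ)`, and a finite abelian group has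
at most as many complex characters as elements (`AddChar.card_addChar_le`). Everything here is
PROVED; no named facts.

* `torChar ψ : GaGm n →* ℂˣ` (the character `(x, y) ↦ y^ψ`), `mem_ker_powMap_iff`,
  `finite_ker_powMap`, `torChar_kmulHom_eq_one` (`ζ^{kχ} = 1` on `ker φ_k`),
  `mem_range_kmulHom_of_torChar` (a `ψ` killing `ker φ_k` is divisible by `k`, via primitive
  `k_j`-th roots of unity);
* **`relIndex_range_kmulHom_le`** — `[Φ' : Φ' ∩ kℤⁿ] ≤ [ker φ_k : ker φ_k ∩ H']` for any subgroup
  `H'` and `Φ'` its character group;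
* **`relIndex_mul_ncard_image_le`** — `[ker φ_k : ker φ_k ∩ H'] · card((Σ·H)/H) ≤
  card((φ_k⁻¹Σ · H')/H')` whenever `φ_k(H') ≤ H`.

## References

* Yu. V. Nesterenko, *Linear forms in logarithms of rational numbers*, LNM 1819 (2003), §5.1,
  Prop. 5.1 and (5.7) (`Card((Σ + G*)/G*)`, the lattice `Φ` and its minors).
* A. Borel, *Linear Algebraic Groups*, 2nd ed., GTM 126 (1991), §8.2–8.5, §8.12 (characters of
  tori and of diagonalisable groups; isogenies).
-/

noncomputable section

open MvPolynomial Module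
open scoped Pointwise

namespace Literature.NumberTheory.Transcendental

namespace GaGm

variable {n : ℕ}

/-! ### Characters of the torus factor -/

/-- The character `(x, y) ↦ y^ψ = ∏ⱼ yⱼ^{ψⱼ}` of `G = 𝔾ₐ × 𝔾ₘⁿ` attached to `ψ ∈ ℤⁿ = X(𝔾ₘⁿ)`.
[cite: Borel1991, §8.5] -/
def torChar (ψ : Fin n → ℤ) : GaGm n →* ℂˣ where
  toFun g := ∏ j, (g.2 j) ^ (ψ j)
  map_one' := by simp
  map_mul' g h := by
    simp only [Prod.snd_mul, Pi.mul_apply, mul_zpow, Finset.prod_mul_distrib]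

/-- Unfolding `torChar`. [cite: Borel1991, §8.5] -/
theorem torChar_apply (ψ : Fin n → ℤ) (g : GaGm n) : torChar ψ g = ∏ j, (g.2 j) ^ (ψ j) := rfl

/-- `charGroup X` is the set of `ψ` with `y^ψ = 1` on `X`. [cite: Borel1991, §8.5] -/
theorem mem_charGroup_iff_torChar {X : Set (GaGm n)} {ψ : Fin n → ℤ} :
    ψ ∈ charGroup X ↔ ∀ g ∈ X, torChar ψ g = 1 := Iff.rfl

/-- Additivity in the character: `y^{ψ + ψ'} = y^ψ · y^{ψ'}`. [cite: Borel1991, §8.5] -/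
theorem torChar_add (ψ ψ' : Fin n → ℤ) (g : GaGm n) : torChar (ψ + ψ') g = torChar ψ g * torChar ψ' g := by
  simp only [torChar_apply, Pi.add_apply, zpow_add, Finset.prod_mul_distrib]

/-- `y^{-ψ} = (y^ψ)⁻¹`. [cite: Borel1991, §8.5] -/
theorem torChar_neg (ψ : Fin n → ℤ) (g : GaGm n) : torChar (-ψ) g = (torChar ψ g)⁻¹ := by
  simp only [torChar_apply, Pi.neg_apply, zpow_neg, Finset.prod_inv_distrib]

/-! ### The kernel of `φ_k` -/

/-- `ker φ_k = {(0, ζ) ; ζ_j^{k_j} = 1}`. [cite: Borel1991, §8.5] -/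
theorem mem_ker_powMap_iff (k : Fin n → ℕ) (g : GaGm n) :
    g ∈ (powMap k).ker ↔ g.1 = 1 ∧ ∀ j, g.2 j ^ k j = 1 := by
  rw [MonoidHom.mem_ker]
  constructor
  · intro h
    refine ⟨?_, fun j => ?_⟩
    · have := congrArg Prod.fst h; simpa using this
    · have := congrFun (congrArg Prod.snd h) j; simpa using this
  · rintro ⟨h1, h2⟩
    refine Prod.ext (by simpa using h1) (funext fun j => ?_)
    simpa using h2 j

/-- `ker φ_k` is finite (`k_j ≥ 1`). [cite: Borel1991, §8.5] -/
theorem finite_ker_powMap {k : Fin n → ℕ} (hk : ∀ j, 1 ≤ k j) : Finite ↥(powMap (n := n) k).ker := by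
  have h := finite_preimage_powMap_singleton hk (1 : GaGm n)
  exact (h.subset fun g hg => by simpa [MonoidHom.mem_ker] using hg).to_subtype

/-- `ζ^{kχ} = 1` for `ζ ∈ ker φ_k`: pulled-back characters kill the kernel. [cite: Borel1991, §8.5] -/
theorem torChar_kmulHom_eq_one (k : Fin n → ℕ) (χ : Fin n → ℤ) {ζ : GaGm n} (hζ : ζ ∈ (powMap k).ker) :
    torChar (kmulHom k χ) ζ = 1 := by
  rw [mem_ker_powMap_iff] at hζ
  rw [torChar_apply]
  refine Finset.prod_eq_one fun j _ => ?_
  rw [kmulHom_apply, zpow_mul, zpow_natCast, hζ.2 j, one_zpow]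

/-- **A character `y^ψ` trivial on `ker φ_k` is a pulled-back character** (`ψ = kχ`): evaluate at
`(0, (1, …, ζ_j, …, 1))` with `ζ_j` a primitive `k_j`-th root of unity. [cite: Borel1991, §8.5] -/
theorem mem_range_kmulHom_of_torChar {k : Fin n → ℕ} (hk : ∀ j, 1 ≤ k j) {ψ : Fin n → ℤ}
    (hψ : ∀ ζ ∈ (powMap k).ker, torChar ψ ζ = 1) : ψ ∈ (kmulHom k).range := by
  classical
  have hdvd : ∀ j, (k j : ℤ) ∣ ψ j := by
    intro j
    have hk0 : k j ≠ 0 := by have := hk j; omega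
    -- a primitive `k_j`-th root of unity, as a unit
    have hprim := Complex.isPrimitiveRoot_exp (k j) hk0
    set u : ℂˣ := (hprim.isUnit hk0).unit with hu
    have hprimu : IsPrimitiveRoot u (k j) := hprim.isUnit_unit hk0
    -- the kernel element `(0, (1, …, u, …, 1))`
    set ζ : GaGm n := ((1 : Multiplicative ℂ), Pi.mulSingle j u) with hζ
    have hζker : ζ ∈ (powMap k).ker := by
      rw [mem_ker_powMap_iff]
      refine ⟨rfl, fun l => ?_⟩
      by_cases hl : l = j
      · subst hl
        simp only [hζ, Pi.mulSingle_eq_same]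
        exact hprimu.pow_eq_one
      · simp [hζ, Pi.mulSingle_eq_of_ne hl]
    have h1 := hψ ζ hζker
    rw [torChar_apply, Finset.prod_eq_single j (fun l _ hl => by simp [hζ, Pi.mulSingle_eq_of_ne hl])
      (fun h => absurd (Finset.mem_univ j) h)] at h1
    simp only [hζ, Pi.mulSingle_eq_same] at h1
    exact (hprimu.zpow_eq_one_iff_dvd (ψ j)).mp h1
  choose c hc using hdvd
  refine ⟨c, funext fun j => ?_⟩
  rw [kmulHom_apply, ← hc j]

/-! ### Counting characters of a finite abelian group -/

/-- A finite abelian group `Q` has at most `|Q|` complex characters, so a type injecting into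
`Q →* ℂ` has at most `|Q|` elements (`AddChar.card_addChar_le`). [folklore] -/
private theorem nat_card_le_of_injective_monoidHom {X Q : Type*} [CommGroup Q] [Finite Q]
    (F : X → (Q →* ℂ)) (hF : Function.Injective F) : Nat.card X ≤ Nat.card Q := by
  classical
  haveI : Fintype Q := Fintype.ofFinite Q
  haveI : Fintype (Additive Q) := Fintype.ofFinite _
  let A : (Q →* ℂ) → AddChar (Additive Q) ℂ := fun f =>
    { toFun := fun a => f (Additive.toMul a)
      map_zero_eq_one' := by simp
      map_add_eq_mul' := fun a b => by simp [toMul_add] }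
  have hA : Function.Injective A := by
    intro f g h
    ext q
    have := DFunLike.congr_fun h (Additive.ofMul q)
    simpa [A] using this
  calc Nat.card X ≤ Nat.card (AddChar (Additive Q) ℂ) := Nat.card_le_card_of_injective _ (hA.comp hF)
    _ ≤ Nat.card (Additive Q) := by
        rw [Nat.card_eq_fintype_card, Nat.card_eq_fintype_card]
        exact AddChar.card_addChar_le _ _
    _ = Nat.card Q := Nat.card_congr Additive.toMul

/-! ### The lattice index is at most the kernel index -/

/-- **`[Φ' : Φ' ∩ kℤⁿ] ≤ [ker φ_k : ker φ_k ∩ H']`** for a subgroup `H'` of `G(ℂ)` with character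
group `Φ' = {ψ ; y^ψ = 1 on H'}`: `ψ ↦ (ζ ↦ ζ^ψ)` maps `Φ'` to complex characters of the finite
abelian group `ker φ_k/(ker φ_k ∩ H')` with kernel `Φ' ∩ kℤⁿ` (`mem_range_kmulHom_of_torChar`), and
a finite abelian group has at most as many characters as elements (`AddChar.card_addChar_le`).
[cite: Borel1991, §8.12 (characters of diagonalisable groups)] -/
theorem relIndex_range_kmulHom_le {k : Fin n → ℕ} (hk : ∀ j, 1 ≤ k j) (H' : Subgroup (GaGm n)) :
    (kmulHom k).range.relIndex (charGroup (H' : Set (GaGm n))) ≤ H'.relIndex (powMap k).ker := by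
  classical
  set Kφ : Subgroup (GaGm n) := (powMap k).ker with hKφ
  set N : Subgroup ↥Kφ := H'.subgroupOf Kφ with hN
  set Φ' : AddSubgroup (Fin n → ℤ) := charGroup (H' : Set (GaGm n)) with hΦ'
  set K₀ : AddSubgroup ↥Φ' := (kmulHom k).range.addSubgroupOf Φ' with hK₀
  haveI : Finite ↥Kφ := finite_ker_powMap hk
  haveI : Finite (↥Kφ ⧸ N) := Quotient.finite _
  -- the character of `ker φ_k / (ker φ_k ∩ H')` attached to `ψ ∈ Φ'`
  let e : ↥Φ' → (↥Kφ →* ℂ) := fun ψ => (Units.coeHom ℂ).comp ((torChar (ψ : Fin n → ℤ)).comp Kφ.subtype)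
  have he : ∀ (ψ : ↥Φ') (ζ : ↥Kφ), e ψ ζ = ((torChar (ψ : Fin n → ℤ) (ζ : GaGm n) : ℂˣ) : ℂ) := fun ψ ζ => rfl
  have hNle : ∀ ψ : ↥Φ', N ≤ (e ψ).ker := fun ψ ζ hζ => by
    rw [hN, Subgroup.mem_subgroupOf] at hζ
    rw [MonoidHom.mem_ker, he, (mem_charGroup_iff_torChar.mp ψ.2) _ hζ, Units.val_one]
  let f : ↥Φ' → (↥Kφ ⧸ N →* ℂ) := fun ψ => QuotientGroup.lift N (e ψ) (hNle ψ)
  have hf : ∀ (ψ : ↥Φ') (ζ : ↥Kφ), f ψ (QuotientGroup.mk ζ) = ((torChar (ψ : Fin n → ℤ) (ζ : GaGm n) : ℂˣ) : ℂ) :=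
    fun ψ ζ => by
      show QuotientGroup.lift N (e ψ) (hNle ψ) (QuotientGroup.mk ζ) = _
      rw [QuotientGroup.lift_mk, he]
  -- two elements of `Φ'` with the same character differ by a pulled-back character
  have hker : ∀ ψ ψ' : ↥Φ', f ψ = f ψ' → -ψ + ψ' ∈ K₀ := by
    intro ψ ψ' hff
    rw [hK₀, AddSubgroup.mem_addSubgroupOf]
    refine mem_range_kmulHom_of_torChar hk fun ζ hζ => ?_
    have h1 : ((torChar (ψ : Fin n → ℤ) ζ : ℂˣ) : ℂ) = ((torChar (ψ' : Fin n → ℤ) ζ : ℂˣ) : ℂ) := by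
      rw [← hf ψ ⟨ζ, hζ⟩, ← hf ψ' ⟨ζ, hζ⟩, hff]
    have h2 : torChar (ψ : Fin n → ℤ) ζ = torChar (ψ' : Fin n → ℤ) ζ := Units.val_injective h1
    change torChar (-(ψ : Fin n → ℤ) + (ψ' : Fin n → ℤ)) ζ = 1
    rw [torChar_add, torChar_neg, h2, inv_mul_cancel]
  -- `f` is constant on the classes modulo `K₀ = Φ' ∩ kℤⁿ`
  have hconst : ∀ ψ ψ' : ↥Φ', -ψ + ψ' ∈ K₀ → f ψ = f ψ' := by
    intro ψ ψ' h
    rw [hK₀, AddSubgroup.mem_addSubgroupOf] at h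
    obtain ⟨χ, hχ⟩ := h
    have hψ' : (ψ' : Fin n → ℤ) = (ψ : Fin n → ℤ) + kmulHom k χ := by
      rw [hχ]; simp
    refine MonoidHom.ext fun q => ?_
    induction q using QuotientGroup.induction_on with
    | H ζ =>
      rw [hf, hf, hψ', torChar_add, torChar_kmulHom_eq_one k χ ζ.2, mul_one]
  -- the induced injection `Φ'/(Φ' ∩ kℤⁿ) ↪ (ker φ_k/(ker φ_k ∩ H') →* ℂ)`
  let F : ↥Φ' ⧸ K₀ → (↥Kφ ⧸ N →* ℂ) :=
    Quotient.lift f fun ψ ψ' (h : QuotientAddGroup.leftRel K₀ ψ ψ') =>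
      hconst ψ ψ' (QuotientAddGroup.leftRel_apply.mp h)
  have hF : Function.Injective F := by
    intro a b
    induction a using Quotient.inductionOn with
    | h ψ =>
      induction b using Quotient.inductionOn with
      | h ψ' =>
        intro h
        exact Quotient.sound (QuotientAddGroup.leftRel_apply.mpr (hker ψ ψ' h))
  -- count
  calc (kmulHom k).range.relIndex Φ' = Nat.card (↥Φ' ⧸ K₀) := rfl
    _ ≤ Nat.card (↥Kφ ⧸ N) := nat_card_le_of_injective_monoidHom F hF
    _ = H'.relIndex Kφ := rfl

/-! ### Counting cosets upstairs -/

/-- **`[ker φ_k : ker φ_k ∩ H'] · card((Σ·H)/H) ≤ card((φ_k⁻¹Σ · H')/H')`** for subgroups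
`H', H` with `φ_k(H') ≤ H` and finite `Σ`: over each coset `σH` met by `Σ` lie at least
`[ker φ_k : ker φ_k ∩ H']` cosets `σ̃ζH'` (`φ_k σ̃ = σ`, `ζ ∈ ker φ_k`) met by `φ_k⁻¹Σ`.
[cite: Nesterenko2003, Prop 5.1 (`Card((Σ + G*)/G*)`)] -/
theorem relIndex_mul_ncard_image_le {k : Fin n → ℕ} (hk : ∀ j, 1 ≤ k j) {H' H : Subgroup (GaGm n)}
    (hH : ∀ h ∈ H', powMap k h ∈ H) {S : Set (GaGm n)} (hS : S.Finite) :
    H'.relIndex (powMap k).ker * Set.ncard ((QuotientGroup.mk : GaGm n → GaGm n ⧸ H) '' S) ≤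
      Set.ncard ((QuotientGroup.mk : GaGm n → GaGm n ⧸ H') '' (powMap k ⁻¹' S)) := by
  classical
  set Kφ : Subgroup (GaGm n) := (powMap k).ker with hKφ
  set N : Subgroup ↥Kφ := H'.subgroupOf Kφ with hN
  set X : Set (GaGm n ⧸ H) := (QuotientGroup.mk : GaGm n → GaGm n ⧸ H) '' S with hX
  set X' : Set (GaGm n ⧸ H') := (QuotientGroup.mk : GaGm n → GaGm n ⧸ H') '' (powMap k ⁻¹' S) with hX'
  haveI : Finite ↥X' := ((finite_preimage_powMap hk hS).image _).to_subtype
  -- representatives: `σ x ∈ S` of `x ∈ X`, a preimage `τ x` of `σ x`, and `rep q ∈ ker φ_k` of `q`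
  have hrepX : ∀ x : ↥X, ∃ σ ∈ S, (QuotientGroup.mk σ : GaGm n ⧸ H) = x := fun x => by
    obtain ⟨σ, hσ, h⟩ := x.2
    exact ⟨σ, hσ, h⟩
  choose σ hσS hσx using hrepX
  have hτ : ∀ x : ↥X, ∃ τ : GaGm n, powMap k τ = σ x := fun x => powMap_surjective hk (σ x)
  choose τ hτ using hτ
  let rep : ↥Kφ ⧸ N → ↥Kφ := Quotient.out
  have hrep : ∀ q : ↥Kφ ⧸ N, (QuotientGroup.mk (rep q) : ↥Kφ ⧸ N) = q := fun q => Quotient.out_eq q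
  -- the injection `X × (ker φ_k / (ker φ_k ∩ H')) ↪ X'`
  have hmem : ∀ (x : ↥X) (q : ↥Kφ ⧸ N),
      (QuotientGroup.mk (τ x * (rep q : GaGm n)) : GaGm n ⧸ H') ∈ X' := fun x q => by
    refine ⟨τ x * (rep q : GaGm n), ?_, rfl⟩
    rw [Set.mem_preimage, map_mul, hτ, (MonoidHom.mem_ker.mp (rep q).2 : powMap k (rep q : GaGm n) = 1), mul_one]
    exact hσS x
  let Ψ : ↥X × (↥Kφ ⧸ N) → ↥X' := fun p => ⟨QuotientGroup.mk (τ p.1 * (rep p.2 : GaGm n)), hmem p.1 p.2⟩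
  have hΨ : Function.Injective Ψ := by
    rintro ⟨x, q⟩ ⟨x', q'⟩ h
    have h1 : (QuotientGroup.mk (τ x * (rep q : GaGm n)) : GaGm n ⧸ H') =
        QuotientGroup.mk (τ x' * (rep q' : GaGm n)) := congrArg Subtype.val h
    rw [QuotientGroup.eq] at h1
    -- apply `φ_k`: `(σ x)⁻¹ σ x' ∈ H`, so `x = x'`
    have h2 : (σ x)⁻¹ * σ x' ∈ H := by
      have h3 := hH _ h1
      rw [map_mul, map_inv, map_mul, map_mul, hτ, hτ,
        (MonoidHom.mem_ker.mp (rep q).2 : powMap k (rep q : GaGm n) = 1),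
        (MonoidHom.mem_ker.mp (rep q').2 : powMap k (rep q' : GaGm n) = 1), mul_one, mul_one] at h3
      exact h3
    have hxx' : x = x' := by
      apply Subtype.ext
      rw [← hσx x, ← hσx x', QuotientGroup.eq]
      exact h2
    subst hxx'
    -- then `(rep q)⁻¹ rep q' ∈ H' ∩ ker φ_k`, so `q = q'`
    have h4 : ((rep q)⁻¹ * rep q' : ↥Kφ) ∈ N := by
      rw [hN, Subgroup.mem_subgroupOf, Subgroup.coe_mul, Subgroup.coe_inv]
      have e : (τ x * (rep q : GaGm n))⁻¹ * (τ x * (rep q' : GaGm n)) = ((rep q : GaGm n))⁻¹ * (rep q' : GaGm n) := by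
        rw [mul_inv_rev, mul_assoc, inv_mul_cancel_left]
      rw [← e]; exact h1
    have hqq' : q = q' := by
      rw [← hrep q, ← hrep q', QuotientGroup.eq]
      exact h4
    rw [hqq']
  -- count
  have hcard := Nat.card_le_card_of_injective Ψ hΨ
  rw [Nat.card_prod, Nat.card_coe_set_eq, Nat.card_coe_set_eq] at hcard
  calc H'.relIndex Kφ * X.ncard = X.ncard * Nat.card (↥Kφ ⧸ N) := by rw [mul_comm]; rfl
    _ ≤ X'.ncard := hcard

end GaGm

end Literature.NumberTheory.Transcendental
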